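import Literature.RepresentationTheory.UnitaryEquivOfGramKernel
import Literature.NumberTheory.Automorphic.HilbertRepSpectrumProofs
import Literature.NumberTheory.Rogawski1990.CurveCohomologicalSpectrum
import Summits.HodgeConjecture.HodgeConjecture.Theorems.F0P3MultiplicityLocal
import Mathlib.Analysis.InnerProductSpace.Projection.Basic
import Mathlib.Analysis.InnerProductSpace.Continuous
import HarnessLib

/-!
# Crux `HLiu418`, K-lane E1′₂ (rank-2 collapse), FILE B — the generic HILBERT layer: non-vanishing matrix coefficients in an irreducible
# representation, orthogonal projections commute with the unitaries stabilising their range, and the JUNCTION «equal matrix coefficients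
# ⇒ unitarily equivalent ⇒ EQUAL under multiplicity `≤ 1` (E1₂ `curveMultiplicityLeOne`)»

Cell `hodgecm-mathlib`, FLOOR 0, programme P5 (`F0_AlbCm`); crux item `stmt-HodgeConjecture-24832` (`HCCMUnconditional.HLiu418`); seat
F0P5-p01 (g3), `--supports stmt-HodgeConjecture-24832` (helper).  THEOREMS ONLY — no definition, no instance, no notation, no `sorry`.
File B of F0P5-p02 (g3)'s cut `F0/P5/p02/CENSUS-KE1prime-collapse.v0.F0P5p02g3.md` (A `…E1pArchCoefficient` disc identity · B this file ·
C `…E1pLevel` · D `…E1pOfE1` head) for the letter E1′₂ `Rogawski1990.curveCohFinComponentUnique_hol` ⇐ E1₂ `curveMultiplicityLeOne` ALONE.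

* §1 (any adelic group datum `𝒢`, any invariant `μ`; `R = 𝒢.rightRegular μ`): `matrixCoeff_toContRep`; **`exists_equiv_isometry_of_matrixCoeff_eq`** ∕
  `areUnitarilyEquivalent_of_matrixCoeff_eq` — families `u : ι → P`, `u′ : ι → P′` of `L²`-classes in two discrete automorphic representations
  with one `u i₀ ≠ 0` and `⟪R(g) u_i, u_j⟫ = ⟪R(g) u′_i, u′_j⟫` give an ISOMETRIC `P.space.toContRep ≃ P′.space.toContRep` matching the families
  (the GNS ∕ Moore–Aronszajn uniqueness theorem ★ `Literature.RepresentationTheory.exists_equiv_isometry_of_matrixCoeff_eq_of_isTopIrreducible`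
  for the irreducible unitary constituents; step 5 of the census is `ι := Unit`); `eq_of_matrixCoeff_eq_of_multiplicity_le_one` (+ multiplicity
  `≤ 1` at `P` ⇒ `P = P′`, ★ `F0P3MultiplicityLocal`); single-vector forms `areUnitarilyEquivalent_of_diagCoeff_eq` ∕ `eq_of_diagCoeff_eq_of_multiplicity_le_one`.
* §2 **non-vanishing coefficients** (census step 3): `exists_inner_ne_zero_of_isTopIrreducible` (generic irreducible `π`: for `x, y ≠ 0` some
  `⟪π g x, y⟫ ≠ 0`, since the orbit of `x` spans a dense subspace ★ `dense_span_orbit_of_isTopIrreducible`) and `exists_inner_rightRegular_ne_zero`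
  (for `x, y ≠ 0` in a discrete automorphic `P`, some `⟪R(g) x, y⟫ ≠ 0`).
* §3 **projections commute with stabilising unitaries** (census step 3, «`pr_S` commutes with `R(1,·)`»): `starProjection_map_comm_of_isUnitary`
  (generic: a unitary `π`, a complete submodule `S` stable under `π g` for `g` in a subgroup `T` ⇒ `P_S (π g v) = π g (P_S v)` for `g ∈ T` — the
  vector `π g (P_S v) ∈ S` has `π g v − π g (P_S v) ⊥ S` because `π g⁻¹` preserves `S` and `π` is unitary; Mathlib `eq_starProjection_of_mem_of_inner_eq_zero`),
  `mem_topologicalClosure_map_of_mem` (closures of stable submodules are stable) and the `rightRegular` specialisations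
  `starProjection_rightRegular_comm`, `rightRegular_mem_topologicalClosure`.
* §4 (the P5 letter binders of ★ `Rogawski1990/CurveCohomologicalSpectrum`): **`eq_of_areUnitarilyEquivalent_of_curveMultiplicityLeOne`** (the E1-FOLD:
  E1₂ + unitary equivalence ⇒ `P = P′`) **`eq_of_matrixCoeff_eq_of_curveMultiplicityLeOne`** (E1₂ + equal matrix coefficients ⇒ `P = P′`) and its single-vector form
  **`eq_of_diagCoeff_eq_of_curveMultiplicityLeOne`** — the last line of head D.
References: Dixmier 1977, §5.4, Prop. 2.4.1, 13.1.3, 13.1.5 [Dixmier1977]; Folland 1995, §3.1 Prop. 3.4, §3.3 Cor. 3.24 [Folland1995]; Borel–Jacquet 1979,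
§4.6 [BorelJacquet1979]; Rogawski 1990, §11.1 Prop. 11.1.1, Prop. 11.2.1 (a), Thm. 11.5.1 (c) [Rogawski1990].
HONEST LABEL: HC_CM is proved only modulo the 7 printed citations (+ declared floor-0 debt) until rung 0 closes; this file discharges none of
them (E1₂ enters as the hypothesis `hE1`).
-/

set_option autoImplicit false
-- the mandated namespace has the single-problem summit's repeated segment (`HodgeConjecture.HodgeConjecture`)
set_option linter.dupNamespace false

noncomputable section

open MeasureTheory NumberField NumberField.InfinitePlace
open scoped InnerProductSpace Matrix ComplexOrder
open Literature.NumberTheory.Automorphic Literature.NumberTheory.Automorphic.UnitaryGroup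
open Literature.NumberTheory.Automorphic.UnitaryCurveForms

namespace Summit.HodgeConjecture.HodgeConjecture.Cruxes.HLiu418.E1pHilbert

/-! ## §1 Generic adelic datum: equal matrix coefficients ⇒ unitary equivalence ⇒ equality under multiplicity `≤ 1` -/

section Generic

variable {K : Type} [Field K] [NumberField K] {𝒢 : AdelicGroupData.{0} K}
  {μ : Measure 𝒢.automorphicQuotient} [SMulInvariantMeasure 𝒢.Adelic 𝒢.automorphicQuotient μ]

/-- The matrix coefficients of the irreducible constituent `P.space.toContRep` are those of the regular representation `R` on the
underlying `L²` classes: `⟪P(g) x, y⟫ = ⟪R(g) x, y⟫`. [cite: BorelJacquet1979, §4.6] -/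
theorem matrixCoeff_toContRep (P : DiscreteAutomorphicRep 𝒢 μ) (g : 𝒢.Adelic) (x y : P.space.toSubmodule) :
    ⟪P.space.toContRep g x, y⟫_ℂ = ⟪𝒢.rightRegular μ g (x : 𝒢.L2 μ), (y : 𝒢.L2 μ)⟫_ℂ := by
  rw [Submodule.coe_inner, ContRepresentation.ClosedSubrep.coe_toContRep_apply]

/-- **Equal matrix coefficients ⇒ an isometric equivalence of the two discrete automorphic representations matching the families.**
For families `u : ι → P`, `u′ : ι → P′` of vectors with one `u i₀ ≠ 0` and `⟪R(g) u_i, u_j⟫ = ⟪R(g) u′_i, u′_j⟫` for all `g ∈ G(𝔸)`, `i, j`: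
GNS uniqueness (★ `exists_equiv_isometry_of_matrixCoeff_eq_of_isTopIrreducible`) for the irreducible unitary `P.space.toContRep`,
`P′.space.toContRep`. [cite: Folland1995, §3.3 Cor. 3.24] [cite: Dixmier1977, Prop. 2.4.1 and 13.1.3] -/
theorem exists_equiv_isometry_of_matrixCoeff_eq (P P' : DiscreteAutomorphicRep 𝒢 μ) {ι : Type*}
    (u : ι → P.space.toSubmodule) (u' : ι → P'.space.toSubmodule) {i₀ : ι} (h0 : u i₀ ≠ 0)
    (h : ∀ (g : 𝒢.Adelic) (i j : ι), ⟪𝒢.rightRegular μ g (u i : 𝒢.L2 μ), (u j : 𝒢.L2 μ)⟫_ℂ =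
      ⟪𝒢.rightRegular μ g (u' i : 𝒢.L2 μ), (u' j : 𝒢.L2 μ)⟫_ℂ) :
    ∃ e : P.space.toContRep.Equiv P'.space.toContRep, Isometry e ∧ ∀ i, e (u i) = u' i :=
  Literature.RepresentationTheory.exists_equiv_isometry_of_matrixCoeff_eq_of_isTopIrreducible P.space.toContRep
    P'.space.toContRep u u' ((𝒢.isUnitary_rightRegular μ).toContRep P.space) ((𝒢.isUnitary_rightRegular μ).toContRep P'.space)
    P.irreducible P'.irreducible h0 fun g i j => by rw [matrixCoeff_toContRep, matrixCoeff_toContRep]; exact h g i j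

/-- **Equal matrix coefficients ⇒ the two discrete automorphic representations are unitarily equivalent** (★ `AreUnitarilyEquivalent`).
[cite: Folland1995, §3.3 Cor. 3.24] [cite: Dixmier1977, Prop. 2.4.1 and 13.1.3] -/
theorem areUnitarilyEquivalent_of_matrixCoeff_eq (P P' : DiscreteAutomorphicRep 𝒢 μ) {ι : Type*}
    (u : ι → P.space.toSubmodule) (u' : ι → P'.space.toSubmodule) {i₀ : ι} (h0 : u i₀ ≠ 0)
    (h : ∀ (g : 𝒢.Adelic) (i j : ι), ⟪𝒢.rightRegular μ g (u i : 𝒢.L2 μ), (u j : 𝒢.L2 μ)⟫_ℂ =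
      ⟪𝒢.rightRegular μ g (u' i : 𝒢.L2 μ), (u' j : 𝒢.L2 μ)⟫_ℂ) :
    ContRepresentation.AreUnitarilyEquivalent P.space.toContRep P'.space.toContRep := by
  obtain ⟨e, he, -⟩ := exists_equiv_isometry_of_matrixCoeff_eq P P' u u' h0 h
  exact ⟨e, he⟩

/-- **Equal matrix coefficients + multiplicity `≤ 1` at `P` ⇒ `P = P′`** (★ `F0P3MultiplicityLocal.eq_of_areUnitarilyEquivalent_space_of_multiplicity_le_one`:
unitarily equivalent irreducible closed subrepresentations of `L²` coincide when the multiplicity is `≤ 1`). [cite: Dixmier1977, §5.4]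
[cite: BorelJacquet1979, §4.6] -/
theorem eq_of_matrixCoeff_eq_of_multiplicity_le_one {P P' : DiscreteAutomorphicRep 𝒢 μ}
    (hm : (𝒢.rightRegular μ).multiplicity P.space.toContRep ≤ 1) {ι : Type*}
    (u : ι → P.space.toSubmodule) (u' : ι → P'.space.toSubmodule) {i₀ : ι} (h0 : u i₀ ≠ 0)
    (h : ∀ (g : 𝒢.Adelic) (i j : ι), ⟪𝒢.rightRegular μ g (u i : 𝒢.L2 μ), (u j : 𝒢.L2 μ)⟫_ℂ =
      ⟪𝒢.rightRegular μ g (u' i : 𝒢.L2 μ), (u' j : 𝒢.L2 μ)⟫_ℂ) : P = P' :=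
  H413.F0P3MultiplicityLocal.eq_of_areUnitarilyEquivalent_space_of_multiplicity_le_one hm
    (areUnitarilyEquivalent_of_matrixCoeff_eq P P' u u' h0 h)

/-- **Single-vector form** (census step 5): two discrete automorphic representations containing non-zero classes `x ∈ P`, `x′ ∈ P′` with THE
SAME DIAGONAL MATRIX COEFFICIENT `⟪R(g) x, x⟫ = ⟪R(g) x′, x′⟫` are unitarily equivalent (the GNS uniqueness theorem for one cyclic vector).
[cite: Folland1995, §3.3 Cor. 3.24] [cite: Dixmier1977, Prop. 2.4.1 and 13.1.3] -/
theorem areUnitarilyEquivalent_of_diagCoeff_eq (P P' : DiscreteAutomorphicRep 𝒢 μ) {x : P.space.toSubmodule}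
    {x' : P'.space.toSubmodule} (hx : x ≠ 0)
    (h : ∀ g : 𝒢.Adelic, ⟪𝒢.rightRegular μ g (x : 𝒢.L2 μ), (x : 𝒢.L2 μ)⟫_ℂ = ⟪𝒢.rightRegular μ g (x' : 𝒢.L2 μ), (x' : 𝒢.L2 μ)⟫_ℂ) :
    ContRepresentation.AreUnitarilyEquivalent P.space.toContRep P'.space.toContRep :=
  areUnitarilyEquivalent_of_matrixCoeff_eq P P' (fun _ : Unit => x) (fun _ : Unit => x') (i₀ := ()) hx fun g _ _ => h g

/-- **Single-vector form + multiplicity `≤ 1` at `P` ⇒ `P = P′`.** [cite: Dixmier1977, §5.4] [cite: Folland1995, §3.3 Cor. 3.24] -/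
theorem eq_of_diagCoeff_eq_of_multiplicity_le_one {P P' : DiscreteAutomorphicRep 𝒢 μ}
    (hm : (𝒢.rightRegular μ).multiplicity P.space.toContRep ≤ 1) {x : P.space.toSubmodule} {x' : P'.space.toSubmodule} (hx : x ≠ 0)
    (h : ∀ g : 𝒢.Adelic, ⟪𝒢.rightRegular μ g (x : 𝒢.L2 μ), (x : 𝒢.L2 μ)⟫_ℂ = ⟪𝒢.rightRegular μ g (x' : 𝒢.L2 μ), (x' : 𝒢.L2 μ)⟫_ℂ) :
    P = P' :=
  H413.F0P3MultiplicityLocal.eq_of_areUnitarilyEquivalent_space_of_multiplicity_le_one hm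
    (areUnitarilyEquivalent_of_diagCoeff_eq P P' hx h)

end Generic

/-! ## §2 Non-vanishing matrix coefficients in an irreducible representation -/

section NonVanishing

variable {G : Type*} [Group G] {E : Type*} [NormedAddCommGroup E] [InnerProductSpace ℂ E] (π : ContRepresentation ℂ G E)

/-- **In a topologically irreducible representation, two non-zero vectors have a non-vanishing matrix coefficient**: for `x, y ≠ 0` there is
`g` with `⟪π g x, y⟫ ≠ 0` — otherwise `y` is orthogonal to the orbit of `x`, whose span is dense (★ `dense_span_orbit_of_isTopIrreducible`).
[cite: Dixmier1977, 13.1.3 and 13.1.5] [cite: Folland1995, §3.1 Prop. 3.4] -/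
theorem exists_inner_ne_zero_of_isTopIrreducible (hirr : π.IsTopIrreducible) {x y : E} (hx : x ≠ 0) (hy : y ≠ 0) :
    ∃ g : G, ⟪π g x, y⟫_ℂ ≠ 0 := by
  by_contra hall
  push Not at hall
  have hd := Literature.RepresentationTheory.dense_span_orbit_of_isTopIrreducible π (fun _ : Unit => x) hirr (i₀ := ()) hx
  refine hy (hd.eq_zero_of_inner_right ℂ fun v hv => ?_)
  induction hv using Submodule.span_induction with
  | mem z hz =>
    obtain ⟨⟨g, -⟩, rfl⟩ := hz
    exact hall g
  | zero => exact inner_zero_left y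
  | add z z' _ _ hz hz' => rw [inner_add_left, hz, hz', add_zero]
  | smul a z _ hz => rw [inner_smul_left, hz, mul_zero]

variable {K : Type} [Field K] [NumberField K] {𝒢 : AdelicGroupData.{0} K}
  {μ : Measure 𝒢.automorphicQuotient} [SMulInvariantMeasure 𝒢.Adelic 𝒢.automorphicQuotient μ]

/-- **Two non-zero classes of a discrete automorphic representation have a non-vanishing matrix coefficient under the regular representation**:
`∃ g, ⟪R(g) x, y⟫ ≠ 0` (census step 3: «irreducibility of `P` gives `g` with `⟪R(g) x₀, y⟫ ≠ 0`»). [cite: Dixmier1977, 13.1.3 and 13.1.5]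
[cite: BorelJacquet1979, §4.6] -/
theorem exists_inner_rightRegular_ne_zero (P : DiscreteAutomorphicRep 𝒢 μ) {x y : P.space.toSubmodule} (hx : x ≠ 0) (hy : y ≠ 0) :
    ∃ g : 𝒢.Adelic, ⟪𝒢.rightRegular μ g (x : 𝒢.L2 μ), (y : 𝒢.L2 μ)⟫_ℂ ≠ 0 := by
  obtain ⟨g, hg⟩ := exists_inner_ne_zero_of_isTopIrreducible P.space.toContRep P.irreducible hx hy
  exact ⟨g, by rwa [matrixCoeff_toContRep] at hg⟩

end NonVanishing

/-! ## §3 Orthogonal projections commute with the unitaries stabilising their range -/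

section Projection

variable {G : Type*} [Group G] {E : Type*} [NormedAddCommGroup E] [InnerProductSpace ℂ E] [CompleteSpace E]
  (π : ContRepresentation ℂ G E)

/-- **A unitary stabilising a closed subspace commutes with the orthogonal projection onto it**: for `π` unitary, a complete submodule `S`
stable under `π g` for all `g` in a subgroup `T`, and `g ∈ T`: `P_S (π g v) = π g (P_S v)` — the vector `π g (P_S v)` lies in `S` and
`π g v − π g (P_S v) = π g (v − P_S v)` is orthogonal to `S` because `π g⁻¹` preserves `S` and `⟪π g a, b⟫ = ⟪a, π g⁻¹ b⟫` (Mathlib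
`Submodule.eq_starProjection_of_mem_of_inner_eq_zero`). [cite: Dixmier1977, 13.1.3] [cite: Folland1995, §3.1 Prop. 3.4] -/
theorem starProjection_map_comm_of_isUnitary (hπ : π.IsUnitary) (S : Submodule ℂ E) [S.HasOrthogonalProjection] (T : Subgroup G)
    (hS : ∀ g ∈ T, ∀ v ∈ S, π g v ∈ S) {g : G} (hg : g ∈ T) (v : E) :
    S.starProjection (π g v) = π g (S.starProjection v) := by
  refine Submodule.eq_starProjection_of_mem_of_inner_eq_zero (hS g hg _ (S.starProjection_apply_mem v)) fun w hw => ?_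
  have hw' : π g⁻¹ w ∈ S := hS g⁻¹ (T.inv_mem hg) w hw
  have key : π g v - π g (S.starProjection v) = π g (v - S.starProjection v) := by rw [map_sub]
  rw [key, ← hπ.inner_map_map g⁻¹, ← mul_apply_eq_comp, ← map_mul, inv_mul_cancel, map_one, one_apply_eq_self]
  exact Submodule.starProjection_inner_eq_zero v _ hw'

omit [CompleteSpace E] in
/-- **The closure of a stable submodule is stable**: if `π g` maps `S` into `S` then it maps `S.topologicalClosure` into itself (continuity).
[cite: Dixmier1977, 13.1.3] -/
theorem mem_topologicalClosure_map_of_mem (S : Submodule ℂ E) {g : G} (hS : ∀ v ∈ S, π g v ∈ S) {v : E}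
    (hv : v ∈ S.topologicalClosure) : π g v ∈ S.topologicalClosure :=
  map_mem_closure (π g).continuous hv fun w hw => hS w hw

variable {K : Type} [Field K] [NumberField K] {𝒢 : AdelicGroupData.{0} K}
  {μ : Measure 𝒢.automorphicQuotient} [SMulInvariantMeasure 𝒢.Adelic 𝒢.automorphicQuotient μ]

/-- **`pr_S` commutes with `R(g)`, `g ∈ T`, for a closed `R(T)`-stable subspace `S ⊆ L²(G(K)\G(𝔸_K))`** (census step 3 with `T :=` the finite-adelic
factor `U(𝔸_f)`, `S :=` the closure of the hol-cotangent classes of `P`). [cite: BorelJacquet1979, §4.6] [cite: Dixmier1977, 13.1.3] -/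
theorem starProjection_rightRegular_comm (S : Submodule ℂ (𝒢.L2 μ)) [S.HasOrthogonalProjection] (T : Subgroup 𝒢.Adelic)
    (hS : ∀ g ∈ T, ∀ v ∈ S, 𝒢.rightRegular μ g v ∈ S) {g : 𝒢.Adelic} (hg : g ∈ T) (v : 𝒢.L2 μ) :
    S.starProjection (𝒢.rightRegular μ g v) = 𝒢.rightRegular μ g (S.starProjection v) :=
  starProjection_map_comm_of_isUnitary (𝒢.rightRegular μ) (𝒢.isUnitary_rightRegular μ) S T hS hg v

/-- **Closures of `R(g)`-stable subspaces of `L²` are `R(g)`-stable.** [cite: BorelJacquet1979, §4.6] -/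
theorem rightRegular_mem_topologicalClosure (S : Submodule ℂ (𝒢.L2 μ)) {g : 𝒢.Adelic} (hS : ∀ v ∈ S, 𝒢.rightRegular μ g v ∈ S)
    {v : 𝒢.L2 μ} (hv : v ∈ S.topologicalClosure) : 𝒢.rightRegular μ g v ∈ S.topologicalClosure :=
  mem_topologicalClosure_map_of_mem (𝒢.rightRegular μ) S hS hv

end Projection

/-! ## §4 At the P5 letter binders: the E1-fold and the matrix-coefficient fold over E1₂ `curveMultiplicityLeOne` -/

section Curve

/-- **The E1-FOLD at rank 2**: under E1₂ `Rogawski1990.curveMultiplicityLeOne` (multiplicity `≤ 1` for every discrete automorphic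
representation of `U(H)`, `H ∈ M₂(L)` with the frame `(dV, t, g)`, of signature `(1,1)` at `ι` and definite elsewhere, `[L:ℚ] ≥ 4` — the
letter binders VERBATIM), two UNITARILY EQUIVALENT discrete automorphic representations `P`, `P′` of `U(H)` are EQUAL.
[cite: Rogawski1990, §11.1 Prop. 11.1.1 (a); Prop. 11.2.1 (a); Thm. 11.5.1 (c)] [cite: Dixmier1977, §5.4] -/
theorem eq_of_areUnitarilyEquivalent_of_curveMultiplicityLeOne
    (hE1 : Literature.NumberTheory.Rogawski1990.curveMultiplicityLeOne)
    (L : Type) [Field L] [NumberField L] [IsCMField L] (ι : L →+* ℂ) (H : Matrix (Fin 2) (Fin 2) L)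
    (dV : Fin 2 → L) (hdV : ∀ i, IsCMField.complexConj L (dV i) = dV i) (hdV0 : ∀ i, dV i ≠ 0)
    (t : L) (ht : t ≠ 0) (g : GL (Fin 2) L)
    (hg : formCongr ((IsCMField.complexConj L : L ≃ₐ[↥(maximalRealSubfield L)] L) : L →+* L) g (t • H) = Matrix.diagonal dV)
    (hsig : ∃ T : GL (Fin 2) ℂ, formCongr (starRingEnd ℂ) T ((Matrix.diagonal dV).map ι) = Matrix.diagonal ![(1 : ℂ), -1])
    (hdef : ∀ τ' : L →+* ℂ, InfinitePlace.mk τ' ≠ InfinitePlace.mk ι → ((Matrix.diagonal dV).map τ').PosDef)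
    (h4 : 4 ≤ Module.finrank ℚ L)
    (μ : Measure (adelicGroupData (↥(maximalRealSubfield L)) L (IsCMField.complexConj L) 2 H).automorphicQuotient)
    [(adelicGroupData (↥(maximalRealSubfield L)) L (IsCMField.complexConj L) 2 H).IsAutomorphicMeasure μ]
    {P P' : DiscreteAutomorphicRep (adelicGroupData (↥(maximalRealSubfield L)) L (IsCMField.complexConj L) 2 H) μ}
    (he : ContRepresentation.AreUnitarilyEquivalent P.space.toContRep P'.space.toContRep) : P = P' :=
  H413.F0P3MultiplicityLocal.eq_of_areUnitarilyEquivalent_space_of_multiplicity_le_one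
    (hE1 L ι H dV hdV hdV0 t ht g hg hsig hdef h4 μ P) he

/-- **E1₂ + equal matrix coefficients ⇒ `P = P′`** (rank 2, the letter binders): for families `u : ι′ → P`, `u′ : ι′ → P′` of `L²`-classes
with one `u i₀ ≠ 0` and `⟪R(x) u_i, u_j⟫ = ⟪R(x) u′_i, u′_j⟫` for all `x ∈ U(H)(𝔸_{L⁺})`, `i, j`, the two discrete automorphic
representations coincide — the junction through which the «rank-2 collapse» road closes E1′₂ `curveCohFinComponentUnique_hol`.
[cite: Rogawski1990, §11.1 Prop. 11.1.1 (a); Prop. 11.2.1 (a); Thm. 11.5.1 (c)] [cite: Folland1995, §3.3 Cor. 3.24] [cite: Dixmier1977, §5.4] -/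
theorem eq_of_matrixCoeff_eq_of_curveMultiplicityLeOne
    (hE1 : Literature.NumberTheory.Rogawski1990.curveMultiplicityLeOne)
    (L : Type) [Field L] [NumberField L] [IsCMField L] (ι : L →+* ℂ) (H : Matrix (Fin 2) (Fin 2) L)
    (dV : Fin 2 → L) (hdV : ∀ i, IsCMField.complexConj L (dV i) = dV i) (hdV0 : ∀ i, dV i ≠ 0)
    (t : L) (ht : t ≠ 0) (g : GL (Fin 2) L)
    (hg : formCongr ((IsCMField.complexConj L : L ≃ₐ[↥(maximalRealSubfield L)] L) : L →+* L) g (t • H) = Matrix.diagonal dV)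
    (hsig : ∃ T : GL (Fin 2) ℂ, formCongr (starRingEnd ℂ) T ((Matrix.diagonal dV).map ι) = Matrix.diagonal ![(1 : ℂ), -1])
    (hdef : ∀ τ' : L →+* ℂ, InfinitePlace.mk τ' ≠ InfinitePlace.mk ι → ((Matrix.diagonal dV).map τ').PosDef)
    (h4 : 4 ≤ Module.finrank ℚ L)
    (μ : Measure (adelicGroupData (↥(maximalRealSubfield L)) L (IsCMField.complexConj L) 2 H).automorphicQuotient)
    [(adelicGroupData (↥(maximalRealSubfield L)) L (IsCMField.complexConj L) 2 H).IsAutomorphicMeasure μ]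
    {P P' : DiscreteAutomorphicRep (adelicGroupData (↥(maximalRealSubfield L)) L (IsCMField.complexConj L) 2 H) μ} {ι' : Type*}
    (u : ι' → P.space.toSubmodule) (u' : ι' → P'.space.toSubmodule) {i₀ : ι'} (h0 : u i₀ ≠ 0)
    (h : ∀ (x : (adelicGroupData (↥(maximalRealSubfield L)) L (IsCMField.complexConj L) 2 H).Adelic) (i j : ι'),
      ⟪(adelicGroupData (↥(maximalRealSubfield L)) L (IsCMField.complexConj L) 2 H).rightRegular μ x
          (u i : (adelicGroupData (↥(maximalRealSubfield L)) L (IsCMField.complexConj L) 2 H).L2 μ),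
        (u j : (adelicGroupData (↥(maximalRealSubfield L)) L (IsCMField.complexConj L) 2 H).L2 μ)⟫_ℂ =
      ⟪(adelicGroupData (↥(maximalRealSubfield L)) L (IsCMField.complexConj L) 2 H).rightRegular μ x
          (u' i : (adelicGroupData (↥(maximalRealSubfield L)) L (IsCMField.complexConj L) 2 H).L2 μ),
        (u' j : (adelicGroupData (↥(maximalRealSubfield L)) L (IsCMField.complexConj L) 2 H).L2 μ)⟫_ℂ) : P = P' :=
  eq_of_matrixCoeff_eq_of_multiplicity_le_one (hE1 L ι H dV hdV hdV0 t ht g hg hsig hdef h4 μ P) u u' h0 h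

/-- **E1₂ + one pair of non-zero classes with the same diagonal matrix coefficient ⇒ `P = P′`** (rank 2, the letter binders; census step 5
verbatim: `x := [ψ w₀]`, `x′ := c^{-1/2} [ψ′ w₀]`). [cite: Rogawski1990, §11.1 Prop. 11.1.1 (a); Prop. 11.2.1 (a); Thm. 11.5.1 (c)]
[cite: Folland1995, §3.3 Cor. 3.24] [cite: Dixmier1977, §5.4] -/
theorem eq_of_diagCoeff_eq_of_curveMultiplicityLeOne
    (hE1 : Literature.NumberTheory.Rogawski1990.curveMultiplicityLeOne)
    (L : Type) [Field L] [NumberField L] [IsCMField L] (ι : L →+* ℂ) (H : Matrix (Fin 2) (Fin 2) L)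
    (dV : Fin 2 → L) (hdV : ∀ i, IsCMField.complexConj L (dV i) = dV i) (hdV0 : ∀ i, dV i ≠ 0)
    (t : L) (ht : t ≠ 0) (g : GL (Fin 2) L)
    (hg : formCongr ((IsCMField.complexConj L : L ≃ₐ[↥(maximalRealSubfield L)] L) : L →+* L) g (t • H) = Matrix.diagonal dV)
    (hsig : ∃ T : GL (Fin 2) ℂ, formCongr (starRingEnd ℂ) T ((Matrix.diagonal dV).map ι) = Matrix.diagonal ![(1 : ℂ), -1])
    (hdef : ∀ τ' : L →+* ℂ, InfinitePlace.mk τ' ≠ InfinitePlace.mk ι → ((Matrix.diagonal dV).map τ').PosDef)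
    (h4 : 4 ≤ Module.finrank ℚ L)
    (μ : Measure (adelicGroupData (↥(maximalRealSubfield L)) L (IsCMField.complexConj L) 2 H).automorphicQuotient)
    [(adelicGroupData (↥(maximalRealSubfield L)) L (IsCMField.complexConj L) 2 H).IsAutomorphicMeasure μ]
    {P P' : DiscreteAutomorphicRep (adelicGroupData (↥(maximalRealSubfield L)) L (IsCMField.complexConj L) 2 H) μ}
    {x : P.space.toSubmodule} {x' : P'.space.toSubmodule} (hx : x ≠ 0)
    (h : ∀ y : (adelicGroupData (↥(maximalRealSubfield L)) L (IsCMField.complexConj L) 2 H).Adelic,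
      ⟪(adelicGroupData (↥(maximalRealSubfield L)) L (IsCMField.complexConj L) 2 H).rightRegular μ y
          (x : (adelicGroupData (↥(maximalRealSubfield L)) L (IsCMField.complexConj L) 2 H).L2 μ),
        (x : (adelicGroupData (↥(maximalRealSubfield L)) L (IsCMField.complexConj L) 2 H).L2 μ)⟫_ℂ =
      ⟪(adelicGroupData (↥(maximalRealSubfield L)) L (IsCMField.complexConj L) 2 H).rightRegular μ y
          (x' : (adelicGroupData (↥(maximalRealSubfield L)) L (IsCMField.complexConj L) 2 H).L2 μ),
        (x' : (adelicGroupData (↥(maximalRealSubfield L)) L (IsCMField.complexConj L) 2 H).L2 μ)⟫_ℂ) : P = P' :=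
  eq_of_diagCoeff_eq_of_multiplicity_le_one (hE1 L ι H dV hdV hdV0 t ht g hg hsig hdef h4 μ P) hx h

end Curve

end Summit.HodgeConjecture.HodgeConjecture.Cruxes.HLiu418.E1pHilbert

end
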